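import Literature.Analysis.InverseSpectral.KreinExistence
import HarnessLib

/-!
# Kreĭn's inverse spectral theorem for strings: the uniqueness theorem (named fact) and the
  assembly of `KreinInverseSpectralTheorem` from it

Librarian fact-decomposition (libsplit-27, 2026-08-16) of the capped named fact
`Literature.Analysis.InverseSpectral.KreinInverseSpectralTheorem` (`KreinString.lean`: Kreĭn's
theorem "the correspondence `S[m, L] ↦ q_S ∈ N_S` is bijective", Tomisaki 1988 §4 / Suzuki 2023 §9 /
Kac–Kreĭn 1974 §11 / Dym–McKean 1976 Ch. 5–6), a conjunction of three printed assertions: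
(i) for every string other than the free half-line the Titchmarsh–Weyl limit exists off `[0, ∞)` and
`q_S ∈ N_S`; (ii) two such strings with the same `q` are equal; (iii) every `q ∈ N_S`, `q ≢ 0`, is a
`q_S`. The fact's seat PROVED (i) (`krein_theorem_part_one`, `KreinStringSpectral.lean`) and (iii)
(`krein_theorem_part_three`, `KreinExistence.lean`: Stieltjes strings, Helly compactness, continuity
of `q` on the negative axis, identity principle) and the reduction
`kreinInverseSpectralTheorem_of_uniqueness : (ii) → KreinInverseSpectralTheorem`, and began the
Kac–Kreĭn / de Branges road to (ii) (`KreinStringWeylSolution.lean`, `KreinStringWeylGram.lean`: the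
Weyl solutions and their Gram identity; `InnerProduct/GramIsometry.lean`: the spectral transform as a
lurking isometry; `Complex/CarlemanTract.lean`, `Complex/CarlemanDichotomy.lean`: the Carleman /
de Branges lemma behind the ordering theorem for chains of de Branges spaces).

What remains is exactly conjunct (ii), **Kreĭn's uniqueness theorem** — in print a theorem in its
own right (Kreĭn 1952; Kac–Kreĭn 1974 §11; Dym–McKean 1976 Ch. 6; Kotani–Watanabe 1982 §2: a string
is uniquely determined by its principal spectral data). This file vendors it as the ONE child named
fact `KreinStringUniqueness` and PROVES the assembly
`KreinInverseSpectralTheorem_holds_of : KreinStringUniqueness → KreinInverseSpectralTheorem`.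
The child does not restate the parent: it is one of its three conjuncts, the other two being
theorems of the tree. Its printed proof: the spectral transform `L²(dm) → L²(σ)` built from the Weyl
solutions (an isometry by the Gram identity), the chain of de Branges subspaces it carries, de
Branges' ordering theorem (whose analytic heart, the Carleman dichotomy, is proved in the tree), and
the recovery of `(x, m(x))` from the chain.

## References

* I. S. Kac, M. G. Kreĭn, *On the spectral functions of the string*, Amer. Math. Soc. Transl. (2)
  103 (1974) 19–102, §11 (uniqueness and existence in the inverse problem). [KacKrein1974]
* M. Tomisaki (1988), §4, Theorem (M. G. Kreĭn): "Kreĭn's correspondence `m ∈ M → k ∈ K` is one to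
  one and onto". [Tomisaki1988]
* H. Dym, H. P. McKean, *Gaussian processes, function theory, and the inverse spectral problem*
  (1976), Ch. 6. [DymMcKean1976]
* S. Kotani, S. Watanabe, *Kreĭn's spectral theory of strings and generalized diffusion processes*,
  LNM 923 (1982), §2. [KotaniWatanabe1982]
-/

open MeasureTheory Filter Set
open _root_.Topology

noncomputable section

namespace Literature.Analysis.InverseSpectral

/-- **Kreĭn's uniqueness theorem for strings (NAMED FACT, not proved here)** — conjunct (ii) of
`KreinInverseSpectralTheorem`: two Kreĭn strings other than the free half-line `S[0, ∞]` whose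
principal Titchmarsh–Weyl functions `q(z) = lim_{x→L} ψ(x,z)/φ(x,z)` agree off `[0, ∞)` are equal
(same length `L`, same mass distribution `dm`). Printed: Tomisaki 1988 §4, Theorem (M. G. Kreĭn) —
"Kreĭn's correspondence `m ∈ M → k ∈ K` is one to one [and onto]"; Kac–Kreĭn 1974 §11; Dym–McKean
1976 Ch. 6; equivalently, a string is determined by its principal spectral data `(b, σ)` (the
Stieltjes data of `q` being unique, `StieltjesDataUnique.lean`). The one child of the decomposition
of `KreinInverseSpectralTheorem` (conjuncts (i) and (iii) are the theorems `krein_theorem_part_one`,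
`krein_theorem_part_three`). Proof in print: the spectral transform built from the Weyl solutions
(`KreinStringWeylGram.lean`, `GramIsometry.lean`), the chain of de Branges subspaces of `L²(σ)` and
de Branges' ordering theorem (Carleman dichotomy: `CarlemanDichotomy.lean`), recovery of `m` from the
chain. [cite: Tomisaki1988, §4 Theorem (M. G. Kreĭn), injectivity] -/
def KreinStringUniqueness : Prop :=
  ∀ S₁ S₂ : KreinString, ¬ S₁.IsTrivial → ¬ S₂.IsTrivial →
    Set.EqOn S₁.principalWeylFunction S₂.principalWeylFunction offNonnegAxis → S₁ = S₂

/-- **Assembly of the decomposition: Kreĭn's uniqueness theorem ⟹ `KreinInverseSpectralTheorem`**,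
conjuncts (i) and (iii) being theorems of the tree (`kreinInverseSpectralTheorem_of_uniqueness`).
[cite: Tomisaki1988, §4 Theorem (M. G. Kreĭn)] -/
theorem KreinInverseSpectralTheorem_holds_of (h : KreinStringUniqueness) :
    KreinInverseSpectralTheorem :=
  kreinInverseSpectralTheorem_of_uniqueness h

/-- Conversely the uniqueness theorem is conjunct (ii) of Kreĭn's theorem (so the child is exactly
what remains). [folklore] -/
theorem KreinStringUniqueness_of (h : KreinInverseSpectralTheorem) : KreinStringUniqueness :=
  h.2.1

end Literature.Analysis.InverseSpectral

end
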